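import Summits.NavierStokesRegularity.OSWSelfSimilar.SheetREvenForms
import Literature.Analysis.OperatorTheory.LionsSolutionOperator
import HarnessLib

/-!
# SHEET-ℝ frame, EVEN ZERO-MASS class `E⁺₀` — dictionary layer 3b: EXISTENCE of the pair solution operator of the realified, shifted,
# PERTURBED linearisation `(A + K + s) u_R − t u_I = g_R`, `(A + K + s) u_I + t u_R = g_I` on `EspE × EspE` (Lions on the product)

HONEST FRAMING (cell ns-blowup GROUP B / zone Z3, case Z3-SR-SPEC EVEN half; 1-D MODEL certificate frame (viscous gCLM/OSW sheet on the
line); not Euler/NS; «violates: none — MODEL»).  Nothing here asserts that a profile exists; no number of record moves.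
Twin of `SheetRResolventPair` §§2–3 / `SheetRPerturbedPair` §§2–3 on the even zero-mass class: `A = −∂² + d∂ + V` real, `K : EspE →L W` an
arbitrary bounded real operator (for the even half of the certificate: `K = −P_nice + a·Ω̄′⊗ℓ̃ + F⁺`, DESIGN-Z3-SR-SPEC-EVEN §5.1/(D4)),
Gårding datum `GardingDataKE` (the even (S1⁺) sentence) = the HYPOTHESIS.

* `KpairE`, `EformK2E`, `PdataE2`, `jmapE2` — the perturbation on pairs, the perturbed shifted pair form
  `((p_R,p_I),(φ,ψ)) ↦ [E_s p_R φ − t·B p_I φ + E_s p_I ψ + t·B p_R ψ] + ∫w(Kp_R)φ + ∫w(Kp_I)ψ` (`E_s` = `EformE` at the shifted potential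
  `V + s`, `B = BcplE`), the pair data pairing and the embedding of test pairs;
* `exists_pairSolutionOperatorKE` — for every real `s > −m` and every `t` there is a bounded LINEAR
  `S : WithLp 2 (W L × W L) →L[ℝ] WithLp 2 (EspE × EspE)` solving the pair system weakly against every ZERO-MASS even test, with
  `‖S G‖ ≤ (4/κ_c(s))‖G‖`, `κ_c(s) = min(c, 4(m + s))` (coercivity on the diagonal: the `±t` cross terms cancel; Lions' theorem in operator form
  `Literature.Analysis.OperatorTheory.exists_solutionOperator_of_coercive`).
Uniqueness (cutoff energy argument with the defect constant) and the complex packaging are the next files.  Four bundled maps; no named fact.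
WHAT THIS IS NOT: not NS.
-/

noncomputable section

namespace Summit.NavierStokesRegularity.OSWSelfSimilar
namespace SheetREvenPairOperator

open _root_.MeasureTheory _root_.Set _root_.Filter _root_.Real SheetRWeakProfilePV SheetRWeakToStrong SheetREnergyClass SheetRWeightedMeasure
  SheetRLinearisedTests SheetREnergySpace SheetRTestSpace SheetRLinearisedFormBounds SheetREvenTests SheetREvenEnergySpace SheetREvenForms
  Literature.Analysis.OperatorTheory
open scoped Topology ENNReal

variable {L D₀ D₁ V₀ c m : ℝ} {d V : ℝ → ℝ}

/-! ### §1 The perturbation on pairs, the pair forms, the embedding of test pairs -/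

section Maps

variable (hL : 0 < L) (K : EspE L hL →L[ℝ] W L)

/-- `(p_R, p_I) ↦ (K p_R, K p_I)`. [folklore] -/
def KpairE : WithLp 2 (EspE L hL × EspE L hL) →L[ℝ] WithLp 2 (W L × W L) :=
  ((WithLp.prodContinuousLinearEquiv 2 ℝ (W L) (W L)).symm : (W L × W L) →L[ℝ] WithLp 2 (W L × W L)).comp
    ((K.comp (WithLp.fstL 2 ℝ (EspE L hL) (EspE L hL))).prod (K.comp (WithLp.sndL 2 ℝ (EspE L hL) (EspE L hL))))

/-- Components of `KpairE`. [folklore] -/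
theorem KpairE_fst_snd (P : WithLp 2 (EspE L hL × EspE L hL)) : (KpairE hL K P).fst = K P.fst ∧ (KpairE hL K P).snd = K P.snd :=
  ⟨rfl, rfl⟩

/-- **The pair data pairing** `((g_R, g_I), (φ, ψ)) ↦ ∫ w g_R φ + ∫ w g_I ψ`. [folklore] -/
def PdataE2 : WithLp 2 (W L × W L) →ₗ[ℝ] (testSpaceE0 × testSpaceE0) →ₗ[ℝ] ℝ :=
  LinearMap.mk₂ ℝ (fun (G : WithLp 2 (W L × W L)) (Φ : testSpaceE0 × testSpaceE0) => PdataE hL G.fst Φ.1 + PdataE hL G.snd Φ.2)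
    (by intro G G' Φ; simp only [WithLp.add_fst, WithLp.add_snd, map_add, LinearMap.add_apply]; ring)
    (by intro a G Φ; simp only [WithLp.smul_fst, WithLp.smul_snd, map_smul, LinearMap.smul_apply, smul_eq_mul]; ring)
    (by intro G Φ Ψ; simp only [Prod.fst_add, Prod.snd_add, map_add]; ring)
    (by intro a G Φ; simp only [Prod.smul_fst, Prod.smul_snd, map_smul, smul_eq_mul]; ring)

/-- Unfolding `PdataE2`. [folklore] -/
theorem PdataE2_apply (G : WithLp 2 (W L × W L)) (Φ : testSpaceE0 × testSpaceE0) :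
    PdataE2 hL G Φ = PdataE hL G.fst Φ.1 + PdataE hL G.snd Φ.2 := by
  simp only [PdataE2, LinearMap.mk₂_apply]

/-- The embedding of test pairs: `(φ, ψ) ↦ (jmapE φ, jmapE ψ)`. [folklore] -/
def jmapE2 : (testSpaceE0 × testSpaceE0) →ₗ[ℝ] WithLp 2 (EspE L hL × EspE L hL) :=
  (WithLp.linearEquiv 2 ℝ (EspE L hL × EspE L hL)).symm.toLinearMap ∘ₗ ((jmapE hL).prodMap (jmapE hL))

/-- Components of `jmapE2`. [folklore] -/
theorem jmapE2_fst_snd (Φ : testSpaceE0 × testSpaceE0) :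
    (jmapE2 hL Φ).fst = jmapE hL Φ.1 ∧ (jmapE2 hL Φ).snd = jmapE hL Φ.2 := ⟨rfl, rfl⟩

/-- `‖jmapE2 (φ, ψ)‖² = ‖jmapE φ‖² + ‖jmapE ψ‖²`, so each component norm is at most `‖jmapE2 (φ, ψ)‖`. [folklore] -/
theorem norm_jmapE_le_norm_jmapE2 (Φ : testSpaceE0 × testSpaceE0) :
    ‖jmapE2 hL Φ‖ ^ 2 = ‖jmapE hL Φ.1‖ ^ 2 + ‖jmapE hL Φ.2‖ ^ 2 ∧
      ‖jmapE hL Φ.1‖ ≤ ‖jmapE2 hL Φ‖ ∧ ‖jmapE hL Φ.2‖ ≤ ‖jmapE2 hL Φ‖ := by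
  obtain ⟨h1, h2⟩ := jmapE2_fst_snd hL Φ
  refine ⟨by rw [WithLp.prod_norm_sq_eq_of_L2, h1, h2], ?_, ?_⟩
  · have := WithLp.norm_fst_le (x := jmapE2 hL Φ); rwa [h1] at this
  · have := WithLp.norm_snd_le (x := jmapE2 hL Φ); rwa [h2] at this

variable (hdm : AEStronglyMeasurable d volume) (hVm : AEStronglyMeasurable V volume)
  (hD₁ : 0 ≤ D₁) (hd : ∀ ξ, |d ξ| ≤ D₀ + D₁ * |ξ|) (hV : ∀ ξ, |V ξ| ≤ V₀) (t : ℝ)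

/-- **The perturbed pair form**: `((p_R,p_I),(φ,ψ)) ↦ [E p_R φ − t·B p_I φ + E p_I ψ + t·B p_R ψ] + ∫w(Kp_R)φ + ∫w(Kp_I)ψ`. [folklore] -/
def EformK2E : WithLp 2 (EspE L hL × EspE L hL) →ₗ[ℝ] (testSpaceE0 × testSpaceE0) →ₗ[ℝ] ℝ :=
  LinearMap.mk₂ ℝ
    (fun (P : WithLp 2 (EspE L hL × EspE L hL)) (Φ : testSpaceE0 × testSpaceE0) =>
      (EformE hL hdm hVm hD₁ hd hV P.fst Φ.1 - t * BcplE hL P.snd Φ.1 + EformE hL hdm hVm hD₁ hd hV P.snd Φ.2 + t * BcplE hL P.fst Φ.2)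
        + (PdataE hL (K P.fst) Φ.1 + PdataE hL (K P.snd) Φ.2))
    (by intro P Q Φ; simp only [WithLp.add_fst, WithLp.add_snd, map_add, LinearMap.add_apply]; ring)
    (by intro a P Φ; simp only [WithLp.smul_fst, WithLp.smul_snd, map_smul, LinearMap.smul_apply, smul_eq_mul]; ring)
    (by intro P Φ Ψ; simp only [Prod.fst_add, Prod.snd_add, map_add]; ring)
    (by intro a P Φ; simp only [Prod.smul_fst, Prod.smul_snd, map_smul, smul_eq_mul]; ring)

/-- Unfolding `EformK2E`. [folklore] -/
theorem EformK2E_apply (P : WithLp 2 (EspE L hL × EspE L hL)) (Φ : testSpaceE0 × testSpaceE0) :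
    EformK2E hL K hdm hVm hD₁ hd hV t P Φ =
      (EformE hL hdm hVm hD₁ hd hV P.fst Φ.1 - t * BcplE hL P.snd Φ.1 + EformE hL hdm hVm hD₁ hd hV P.snd Φ.2 + t * BcplE hL P.fst Φ.2)
        + (PdataE hL (K P.fst) Φ.1 + PdataE hL (K P.snd) Φ.2) := by
  simp only [EformK2E, LinearMap.mk₂_apply]

end Maps

/-! ### §2 Existence: Lions on the product -/

/-- **THE EVEN PAIR SOLUTION OPERATOR (existence).**  Under `κ`-coercivity of the perturbed form on zero-mass even tests (`κ > 0`) and for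
every coupling constant `t`, there is a bounded LINEAR `S : WithLp 2 (W L × W L) →L[ℝ] WithLp 2 (EspE × EspE)` such that for
`(p_R, p_I) = S (g_R, g_I)` and every ZERO-MASS even test `(v, v₁)`:
`linForm(u_R; v) + ∫w(Kp_R)v − t∫w u_I v = ∫w g_R v` and `linForm(u_I; v) + ∫w(Kp_I)v + t∫w u_R v = ∫w g_I v` (`u_• = profile p_•`), with
`‖S G‖ ≤ (4/κ)‖G‖`. [folklore] -/
theorem exists_pairSolutionOperatorKE_of_coercive (hL : 0 < L) (K : EspE L hL →L[ℝ] W L) (hdm : AEStronglyMeasurable d volume)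
    (hVm : AEStronglyMeasurable V volume) (hD₁ : 0 ≤ D₁) (hd : ∀ ξ, |d ξ| ≤ D₀ + D₁ * |ξ|) (hV : ∀ ξ, |V ξ| ≤ V₀) (t : ℝ) {κ : ℝ}
    (hκ : 0 < κ)
    (hcoerK : ∀ vp : testSpaceE0, κ * ‖jmapE hL vp‖ ^ 2 ≤
      linForm L d V vp.1.1 vp.1.2 vp.1.1 vp.1.2 + ∫ y, (L ^ 2 + y ^ 2) * (((K (jmapE hL vp) : W L) : ℝ → ℝ) y * vp.1.1 y)) :
    ∃ S : WithLp 2 (W L × W L) →L[ℝ] WithLp 2 (EspE L hL × EspE L hL),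
      (∀ (G : WithLp 2 (W L × W L)) (v v₁ : ℝ → ℝ), IsCompactTestE v v₁ → ∫ y, v y = 0 →
        linForm L d V (profile (S G).fst) (derE (S G).fst) v v₁
              + (∫ y, (L ^ 2 + y ^ 2) * (((K (S G).fst : W L) : ℝ → ℝ) y * v y))
              - t * ∫ y, (L ^ 2 + y ^ 2) * (profile (S G).snd y * v y) = ∫ y, (L ^ 2 + y ^ 2) * ((G.fst : ℝ → ℝ) y * v y) ∧
          linForm L d V (profile (S G).snd) (derE (S G).snd) v v₁
              + (∫ y, (L ^ 2 + y ^ 2) * (((K (S G).snd : W L) : ℝ → ℝ) y * v y))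
              + t * ∫ y, (L ^ 2 + y ^ 2) * (profile (S G).fst y * v y) = ∫ y, (L ^ 2 + y ^ 2) * ((G.snd : ℝ → ℝ) y * v y)) ∧
      ∀ G : WithLp 2 (W L × W L), ‖S G‖ ≤ 4 / κ * ‖G‖ := by
  haveI : CompleteSpace (EspE L hL) := completeSpace_EspE hL
  -- fixed-test bounds
  have hE : ∀ Φ : testSpaceE0 × testSpaceE0, ∃ C : ℝ, ∀ P : WithLp 2 (EspE L hL × EspE L hL),
      |EformK2E hL K hdm hVm hD₁ hd hV t P Φ| ≤ C * ‖P‖ := by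
    intro Φ
    obtain ⟨K₁, hK₁⟩ : ∃ C : ℝ, ∀ p : EspE L hL, |EformE hL hdm hVm hD₁ hd hV p Φ.1| ≤ C * ‖p‖ :=
      ⟨_, fun p => by rw [EformE_apply]; exact (abs_linForm_profileE_le hL hdm hVm hD₁ hd hV Φ.1.2.1.toIsCompactTestAny p).2⟩
    obtain ⟨K₂, hK₂⟩ : ∃ C : ℝ, ∀ p : EspE L hL, |EformE hL hdm hVm hD₁ hd hV p Φ.2| ≤ C * ‖p‖ :=
      ⟨_, fun p => by rw [EformE_apply]; exact (abs_linForm_profileE_le hL hdm hVm hD₁ hd hV Φ.2.2.1.toIsCompactTestAny p).2⟩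
    refine ⟨max K₁ 0 + |t| * (4 * ‖jmapE hL Φ.1‖) + max K₂ 0 + |t| * (4 * ‖jmapE hL Φ.2‖)
      + (2 * ‖K‖ * ‖jmapE hL Φ.1‖ + 2 * ‖K‖ * ‖jmapE hL Φ.2‖), fun P => ?_⟩
    rw [EformK2E_apply]
    have hf : ‖P.fst‖ ≤ ‖P‖ := WithLp.norm_fst_le (x := P)
    have hs : ‖P.snd‖ ≤ ‖P‖ := WithLp.norm_snd_le (x := P)
    have hb1 : |EformE hL hdm hVm hD₁ hd hV P.fst Φ.1| ≤ max K₁ 0 * ‖P‖ :=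
      (hK₁ P.fst).trans ((mul_le_mul_of_nonneg_right (le_max_left _ _) (norm_nonneg _)).trans
        (mul_le_mul_of_nonneg_left hf (le_max_right _ _)))
    have hb2 : |EformE hL hdm hVm hD₁ hd hV P.snd Φ.2| ≤ max K₂ 0 * ‖P‖ :=
      (hK₂ P.snd).trans ((mul_le_mul_of_nonneg_right (le_max_left _ _) (norm_nonneg _)).trans
        (mul_le_mul_of_nonneg_left hs (le_max_right _ _)))
    have h3 : |t * BcplE hL P.snd Φ.1| ≤ |t| * (4 * ‖jmapE hL Φ.1‖) * ‖P‖ := by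
      rw [abs_mul]
      have := (integrable_profileE_mul_test hL P.snd Φ.1).2
      rw [← BcplE_apply] at this
      calc |t| * |BcplE hL P.snd Φ.1| ≤ |t| * (4 * ‖P.snd‖ * ‖jmapE hL Φ.1‖) := mul_le_mul_of_nonneg_left this (abs_nonneg t)
        _ ≤ |t| * (4 * ‖P‖ * ‖jmapE hL Φ.1‖) := by gcongr
        _ = |t| * (4 * ‖jmapE hL Φ.1‖) * ‖P‖ := by ring
    have h4 : |t * BcplE hL P.fst Φ.2| ≤ |t| * (4 * ‖jmapE hL Φ.2‖) * ‖P‖ := by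
      rw [abs_mul]
      have := (integrable_profileE_mul_test hL P.fst Φ.2).2
      rw [← BcplE_apply] at this
      calc |t| * |BcplE hL P.fst Φ.2| ≤ |t| * (4 * ‖P.fst‖ * ‖jmapE hL Φ.2‖) := mul_le_mul_of_nonneg_left this (abs_nonneg t)
        _ ≤ |t| * (4 * ‖P‖ * ‖jmapE hL Φ.2‖) := by gcongr
        _ = |t| * (4 * ‖jmapE hL Φ.2‖) * ‖P‖ := by ring
    have h5 : |PdataE hL (K P.fst) Φ.1| ≤ 2 * ‖K‖ * ‖jmapE hL Φ.1‖ * ‖P‖ := by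
      refine (abs_PdataE_le hL (K P.fst) Φ.1).trans ?_
      have := K.le_opNorm P.fst
      calc 2 * ‖K P.fst‖ * ‖jmapE hL Φ.1‖ ≤ 2 * (‖K‖ * ‖P‖) * ‖jmapE hL Φ.1‖ := by gcongr; exact this.trans (by gcongr)
        _ = 2 * ‖K‖ * ‖jmapE hL Φ.1‖ * ‖P‖ := by ring
    have h6 : |PdataE hL (K P.snd) Φ.2| ≤ 2 * ‖K‖ * ‖jmapE hL Φ.2‖ * ‖P‖ := by
      refine (abs_PdataE_le hL (K P.snd) Φ.2).trans ?_
      have := K.le_opNorm P.snd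
      calc 2 * ‖K P.snd‖ * ‖jmapE hL Φ.2‖ ≤ 2 * (‖K‖ * ‖P‖) * ‖jmapE hL Φ.2‖ := by gcongr; exact this.trans (by gcongr)
        _ = 2 * ‖K‖ * ‖jmapE hL Φ.2‖ * ‖P‖ := by ring
    have hA : |EformE hL hdm hVm hD₁ hd hV P.fst Φ.1 - t * BcplE hL P.snd Φ.1 + EformE hL hdm hVm hD₁ hd hV P.snd Φ.2
        + t * BcplE hL P.fst Φ.2|
        ≤ |EformE hL hdm hVm hD₁ hd hV P.fst Φ.1| + |t * BcplE hL P.snd Φ.1| + |EformE hL hdm hVm hD₁ hd hV P.snd Φ.2|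
            + |t * BcplE hL P.fst Φ.2| :=
      (abs_add_le _ _).trans (add_le_add ((abs_add_le _ _).trans (add_le_add (abs_sub _ _) le_rfl)) le_rfl)
    have hB : |PdataE hL (K P.fst) Φ.1 + PdataE hL (K P.snd) Φ.2| ≤ |PdataE hL (K P.fst) Φ.1| + |PdataE hL (K P.snd) Φ.2| :=
      abs_add_le _ _
    calc _ ≤ |EformE hL hdm hVm hD₁ hd hV P.fst Φ.1 - t * BcplE hL P.snd Φ.1 + EformE hL hdm hVm hD₁ hd hV P.snd Φ.2
            + t * BcplE hL P.fst Φ.2| + |PdataE hL (K P.fst) Φ.1 + PdataE hL (K P.snd) Φ.2| := abs_add_le _ _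
      _ ≤ (max K₁ 0 * ‖P‖ + |t| * (4 * ‖jmapE hL Φ.1‖) * ‖P‖ + max K₂ 0 * ‖P‖ + |t| * (4 * ‖jmapE hL Φ.2‖) * ‖P‖)
          + (2 * ‖K‖ * ‖jmapE hL Φ.1‖ * ‖P‖ + 2 * ‖K‖ * ‖jmapE hL Φ.2‖ * ‖P‖) := by
          refine add_le_add (hA.trans ?_) (hB.trans (add_le_add h5 h6))
          gcongr
      _ = _ := by ring
  -- coercivity on the diagonal: cross terms cancel, K-terms are the hypothesis'
  have hcoer2 : ∀ Φ : testSpaceE0 × testSpaceE0, κ * ‖jmapE2 hL Φ‖ ^ 2 ≤ EformK2E hL K hdm hVm hD₁ hd hV t (jmapE2 hL Φ) Φ := by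
    intro Φ
    obtain ⟨h1, h2⟩ := jmapE2_fst_snd hL Φ
    rw [EformK2E_apply, h1, h2, BcplE_jmapE_symm hL Φ.2 Φ.1, EformE_jmapE, EformE_jmapE, (norm_jmapE_le_norm_jmapE2 hL Φ).1,
      PdataE_apply, PdataE_apply]
    have hc1 := hcoerK Φ.1
    have hc2 := hcoerK Φ.2
    nlinarith
  have hP : ∀ (G : WithLp 2 (W L × W L)) (Φ : testSpaceE0 × testSpaceE0), |PdataE2 hL G Φ| ≤ 4 * ‖G‖ * ‖jmapE2 hL Φ‖ := by
    intro G Φ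
    rw [PdataE2_apply]
    obtain ⟨-, hj1, hj2⟩ := norm_jmapE_le_norm_jmapE2 hL Φ
    have hf : ‖G.fst‖ ≤ ‖G‖ := WithLp.norm_fst_le (x := G)
    have hs : ‖G.snd‖ ≤ ‖G‖ := WithLp.norm_snd_le (x := G)
    have h1 := abs_PdataE_le hL G.fst Φ.1
    have h2 := abs_PdataE_le hL G.snd Φ.2
    calc |PdataE hL G.fst Φ.1 + PdataE hL G.snd Φ.2| ≤ |PdataE hL G.fst Φ.1| + |PdataE hL G.snd Φ.2| := abs_add_le _ _
      _ ≤ 2 * ‖G.fst‖ * ‖jmapE hL Φ.1‖ + 2 * ‖G.snd‖ * ‖jmapE hL Φ.2‖ := add_le_add h1 h2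
      _ ≤ 2 * ‖G‖ * ‖jmapE2 hL Φ‖ + 2 * ‖G‖ * ‖jmapE2 hL Φ‖ := by gcongr
      _ = 4 * ‖G‖ * ‖jmapE2 hL Φ‖ := by ring
  obtain ⟨S, hS, hSn⟩ := exists_solutionOperator_of_coercive (F := WithLp 2 (EspE L hL × EspE L hL)) (jmapE2 hL)
    (fun Φ => ‖jmapE2 hL Φ‖) (fun _ => norm_nonneg _) (C := 1) zero_le_one (fun Φ => by rw [one_mul])
    (EformK2E hL K hdm hVm hD₁ hd hV t) hE hκ hcoer2 (PdataE2 hL) (CP := 4) (by norm_num) hP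
  refine ⟨S, fun G v v₁ hv hv0 => ?_, fun G => ?_⟩
  · have hmem : ((v, v₁) : (ℝ → ℝ) × (ℝ → ℝ)) ∈ testSpaceE0 := ⟨hv, hv0⟩
    have h1 := hS G (⟨(v, v₁), hmem⟩, 0)
    have h2 := hS G (0, ⟨(v, v₁), hmem⟩)
    rw [EformK2E_apply, PdataE2_apply] at h1 h2
    simp only [map_zero, mul_zero, add_zero, sub_zero, zero_add] at h1 h2
    rw [EformE_apply, BcplE_apply, PdataE_apply, PdataE_apply] at h1 h2
    exact ⟨by linarith, by linarith⟩
  · calc ‖S G‖ ≤ 4 * (1 / κ) * ‖G‖ := hSn G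
      _ = 4 / κ * ‖G‖ := by ring

/-- **THE EVEN PAIR SOLUTION OPERATOR from the Gårding datum, at the shifted potential.**  For `GardingDataKE L hL d V K D₀ D₁ V₀ c m`, a
real shift `s > −m` and any `t`: a bounded linear `S` solving, weakly against every ZERO-MASS even test,
`linForm_{V+s}(u_R; v) + ∫w(Kp_R)v − t∫w u_I v = ∫w g_R v`, `linForm_{V+s}(u_I; v) + ∫w(Kp_I)v + t∫w u_R v = ∫w g_I v`, with
`‖S G‖ ≤ (4/κ_c(s))‖G‖`, `κ_c(s) = min(c, 4(m + s))`. [folklore] -/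
theorem exists_pairSolutionOperatorKE {hL : 0 < L} {K : EspE L hL →L[ℝ] W L} (h : GardingDataKE L hL d V K D₀ D₁ V₀ c m)
    {s : ℝ} (hs : -m < s) (t : ℝ) :
    ∃ S : WithLp 2 (W L × W L) →L[ℝ] WithLp 2 (EspE L hL × EspE L hL),
      (∀ (G : WithLp 2 (W L × W L)) (v v₁ : ℝ → ℝ), IsCompactTestE v v₁ → ∫ y, v y = 0 →
        linForm L d (fun ξ => V ξ + s) (profile (S G).fst) (derE (S G).fst) v v₁
              + (∫ y, (L ^ 2 + y ^ 2) * (((K (S G).fst : W L) : ℝ → ℝ) y * v y))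
              - t * ∫ y, (L ^ 2 + y ^ 2) * (profile (S G).snd y * v y) = ∫ y, (L ^ 2 + y ^ 2) * ((G.fst : ℝ → ℝ) y * v y) ∧
          linForm L d (fun ξ => V ξ + s) (profile (S G).snd) (derE (S G).snd) v v₁
              + (∫ y, (L ^ 2 + y ^ 2) * (((K (S G).snd : W L) : ℝ → ℝ) y * v y))
              + t * ∫ y, (L ^ 2 + y ^ 2) * (profile (S G).fst y * v y) = ∫ y, (L ^ 2 + y ^ 2) * ((G.snd : ℝ → ℝ) y * v y)) ∧
      ∀ G : WithLp 2 (W L × W L), ‖S G‖ ≤ 4 / min c (4 * (m + s)) * ‖G‖ := by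
  obtain ⟨hVsm, hVs⟩ := shift_hypsE h s
  exact exists_pairSolutionOperatorKE_of_coercive hL K h.d_meas hVsm h.D₁_nonneg h.d_le hVs t (kappaE_pos h hs)
    (coerciveKE_shift h s)

end SheetREvenPairOperator
end Summit.NavierStokesRegularity.OSWSelfSimilar

end
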